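import Summits.CriticalPhenomena.PercolationContinuityZ3.Theorems.Transplant.BoxProdZdTubes
import HarnessLib

/-!
# The side-on product theorem, IV: a transitive (or quasi-transitive) factor is free — `LineSkeletonNeg (X □ Y)` from `LineSkeletonNeg Y` for
# EVERY connected, locally finite, bounded-degree, (quasi-)transitive `X`; hence `X □ Y □ ℤ` is a D″ customer

builds on p205010 (kernel theorem, internal audit signed; external expert review pending) — nothing in this file uses p205010.
Lane `prim-bschramm`, seat `prim-bschramm-p4` (gen 8; PART C3, METHOD = abstract closing argument: INPUT(G) as weak as possible); helper file
(`--supports stmt-CriticalPhenomena-4575 --as helper`).  Memo: `HOME/bschramm/P4-GENERAL.md` §22.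

THE POINT.  The height of a factor extends to the product by ignoring the other factor: `ψ(x, y) = ψ_Y(y)`.  Everything the interface asks survives —
frames are products of a (quasi-)transitivity witness of `X` with the frames of `Y`, the reflection is `id × ρ_Y`, unit steps live in the `Y`-slice,
and the strips `X × strip_Y` are connected because `X` is.  So the weakest INPUT this lineage defends for PRODUCTS reads (with `BoxProdZdTubes`):
  **INPUT(X □ Y □ ℤ) = X connected, locally finite, bounded degree, quasi-transitive (nothing else) ∧ Y carries a `LineSkeletonNeg`**
⟹ `PlanarSkeletonSign ((X □ Y) □ ℤ)` with Φ2 at `p_c` ⟹ `θ(p_c) = 0` at every vertex modulo `SamePDropOfSkeletonSign` (modulo the single-type node of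
record when `X` is vertex-transitive and `Y` has one type).  Examples: `X □ ℍ □ ℤ` (honeycomb), `X □ N_{m,2} □ ℤ`, `X □ ℤ²` (= the lane's product class,
here re-derived modulo the D″ node instead of the node of record — a regression, not a new theorem), for every such `X`.
* §1 **`LineSkeletonNeg.prodLeft`** (quasi-transitive `X`, base set `V₀ ×ˢ types_Y`) and **`prodLeftT`** (transitive `X`, ONE `X`-type);
* §2 **`prodLeftZ_criticalContinuity_of_signNode`**, **`prodLeftZ_criticalContinuity_of_signNode₁`** (`X` transitive, `Y` one type).
[cite: BenjaminiSchramm1996, Conj. 4; §2 (quasi-transitive graphs, products)] [cite: KozmaNitzan2024, §1 p. 2 (approach 1)] [cite: MartineauSevero2019, Cor. 2.2]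
-/

noncomputable section

namespace Summit.CriticalPhenomena.PercolationContinuityZ3.Theorems.Transplant

namespace LineSkeletonNeg

open MeasureTheory Literature.Probability.Percolation Literature.Probability.LatticeModels SimpleGraph
open Literature.Barriers.CriticalPhenomena (IsQuasiTransitive IsGraphTransitive countable_of_connected_of_locallyFinite)
open scoped Classical

variable {U : Type} {X : SimpleGraph U} [X.LocallyFinite]
variable {W : Type} {Y : SimpleGraph W} [Y.LocallyFinite] (Ψ : LineSkeletonNeg Y)
variable [(X □ Y).LocallyFinite]

/-! ## §1 The product with a free (quasi-)transitive factor -/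

/-- The strip of the lifted height is `X × strip_Y`. [folklore] -/
theorem mem_setOf_prodLeft_iff (t : U × W) (ℓ : ℕ) (w : U × W) :
    w ∈ {u : U × W | |Ψ.ψ u.2 - Ψ.ψ t.2| ≤ (ℓ : ℤ)} ↔ w.2 ∈ Ψ.strip t.2 ℓ := Iff.rfl

omit [X.LocallyFinite] [(X □ Y).LocallyFinite] in
/-- `X × strip` is connected when `X` and the strip are. [folklore] -/
theorem induce_prodStrip_connected (hc : X.Connected) {t : W} (ht : t ∈ Ψ.types) (ℓ : ℕ) (hℓ : 1 ≤ ℓ) (x : U) :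
    ((X □ Y).induce {u : U × W | |Ψ.ψ u.2 - Ψ.ψ ((x, t) : U × W).2| ≤ (ℓ : ℤ)}).Connected := by
  set C : Set (U × W) := {u : U × W | |Ψ.ψ u.2 - Ψ.ψ ((x, t) : U × W).2| ≤ (ℓ : ℤ)} with hC
  let f : SimpleGraph.boxProd X (Y.induce (Ψ.strip t ℓ)) →g (X □ Y).induce C :=
    { toFun := fun ab => ⟨(ab.1, ab.2.1), ab.2.2⟩
      map_rel' := by
        rintro ⟨a, b⟩ ⟨a', b'⟩ h
        rcases boxProd_adj.1 h with ⟨h1, h2⟩ | ⟨h1, h2⟩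
        · subst h2
          simp only [comap_adj, Function.Embedding.coe_subtype]
          exact boxProd_adj.2 (Or.inl ⟨h1, rfl⟩)
        · subst h2
          simp only [comap_adj, Function.Embedding.coe_subtype] at h1 ⊢
          exact boxProd_adj.2 (Or.inr ⟨h1, rfl⟩) }
  have hf : Function.Surjective f := by
    rintro ⟨⟨a, b⟩, hab⟩
    exact ⟨(a, ⟨b, hab⟩), rfl⟩
  exact (hc.boxProd (Ψ.strip_connected t ht ℓ hℓ)).map f hf

/-- **THE FREE FACTOR**: for `X` connected with a degree bound and a quasi-transitivity witness `V₀`, and `Y` with a `LineSkeletonNeg`, the product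
`X □ Y` carries a `LineSkeletonNeg` with height `ψ(x, y) = ψ_Y(y)`, base set `V₀ × types_Y`, frames `γ × α`, reflection `id × ρ_Y`, steps in the
`Y`-slice, strips `X × strip_Y`. [cite: BenjaminiSchramm1996, §2 (quasi-transitive graphs)] -/
def prodLeft (hc : X.Connected) {ΔX : ℕ} (hΔ : ∀ x, X.degree x ≤ ΔX) (V₀ : Finset U) (hV₀ : ∀ v : U, ∃ γ : X ≃g X, γ v ∈ V₀) :
    LineSkeletonNeg (X □ Y) where
  ψ := fun u => Ψ.ψ u.2
  lip := by
    intro u v h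
    rcases boxProd_adj.1 h with ⟨_, h2⟩ | ⟨h1, _⟩
    · rw [h2, sub_self, abs_zero]; exact zero_le_one
    · exact Ψ.lip h1
  types := V₀ ×ˢ Ψ.types
  frame := by
    intro v
    obtain ⟨γ, hγ⟩ := hV₀ v.1
    obtain ⟨t, ht, α, hαt, hα⟩ := Ψ.frame v.2
    refine ⟨(γ v.1, t), Finset.mk_mem_product hγ ht, boxProdIso γ.symm α, ?_, fun w => ?_⟩
    · rw [boxProdIso_apply]
      simp only [RelIso.symm_apply_apply, hαt]
    · rw [boxProdIso_apply]; exact hα w.2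
  neg := by
    intro tu htu
    obtain ⟨-, hu⟩ := Finset.mem_product.1 htu
    obtain ⟨β, hβu, hβ⟩ := Ψ.neg tu.2 hu
    refine ⟨boxProdIso (RelIso.refl _) β, ?_, fun w => ?_⟩
    · rw [boxProdIso_apply, hβu]; rfl
    · rw [boxProdIso_apply]; exact hβ w.2
  Δ := ΔX + Ψ.Δ
  degree_le := fun v => by
    rw [degree_boxProd]
    exact add_le_add (hΔ v.1) (Ψ.degree_le v.2)
  step := by
    intro v σ
    obtain ⟨v', hadj, hψ⟩ := Ψ.step v.2 σ
    exact ⟨(v.1, v'), boxProd_adj.2 (Or.inr ⟨hadj, rfl⟩), hψ⟩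
  strip_connected := by
    rintro ⟨x, t⟩ htu ℓ hℓ
    obtain ⟨-, ht⟩ := Finset.mem_product.1 htu
    exact Ψ.induce_prodStrip_connected hc ht ℓ hℓ x

/-- The base set of `prodLeft`. [folklore] -/
theorem prodLeft_types (hc : X.Connected) {ΔX : ℕ} (hΔ : ∀ x, X.degree x ≤ ΔX) (V₀ : Finset U) (hV₀ : ∀ v : U, ∃ γ : X ≃g X, γ v ∈ V₀) :
    (Ψ.prodLeft hc hΔ V₀ hV₀).types = V₀ ×ˢ Ψ.types := rfl

/-- **Vertex-transitive `X`: ONE `X`-type** (`V₀ = {x₀}`). [cite: BenjaminiSchramm1996, §2] -/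
def prodLeftT (hc : X.Connected) {ΔX : ℕ} (hΔ : ∀ x, X.degree x ≤ ΔX) (hT : IsGraphTransitive X) (x₀ : U) : LineSkeletonNeg (X □ Y) :=
  Ψ.prodLeft hc hΔ {x₀} fun v => by obtain ⟨γ, hγ⟩ := hT v x₀; exact ⟨γ, by rw [hγ]; exact Finset.mem_singleton_self _⟩

/-- Its base set: `{x₀} × types_Y`. [folklore] -/
theorem prodLeftT_types (hc : X.Connected) {ΔX : ℕ} (hΔ : ∀ x, X.degree x ≤ ΔX) (hT : IsGraphTransitive X) (x₀ : U) :
    (Ψ.prodLeftT hc hΔ hT x₀).types = {x₀} ×ˢ Ψ.types := rfl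

/-! ## §2 `X □ Y □ ℤ` is a D″ customer -/

variable [((X □ Y) □ zdGraph 1).LocallyFinite]

include Ψ in
/-- **THEOREM (multi-type node): `SamePDropOfSkeletonSign → θ_{(X □ Y) □ ℤ}(v, p_c) = 0` at every vertex**, for every connected, locally finite,
bounded-degree, quasi-transitive `X` and every `Y` carrying a `LineSkeletonNeg` (Φ2 by tubes, no transverse coordinate).
[cite: BenjaminiSchramm1996, Conj. 4] [cite: MartineauSevero2019, Cor. 2.2] -/
theorem prodLeftZ_criticalContinuity_of_signNode (hD : SamePDropOfSkeletonSign) (hc : X.Connected) {ΔX : ℕ} (hΔ : ∀ x, X.degree x ≤ ΔX)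
    (hq : IsQuasiTransitive X) (v : (U × W) × Site 1) :
    theta ((X □ Y) □ zdGraph 1) v (criticalProbIOf ((X □ Y) □ zdGraph 1) v) = 0 :=
  (Ψ.prodLeft hc hΔ (Classical.choose hq) (Classical.choose_spec hq)).prodInt_criticalContinuity_of_signNode' hD v

/-- **THEOREM (node of record): `SamePDropOfSkeletonSign₁ → θ_{(X □ Y) □ ℤ}(v, p_c) = 0` at every vertex** when `X` is vertex-TRANSITIVE and `Y`'s
skeleton has one type. [cite: BenjaminiSchramm1996, Conj. 4] [cite: MartineauSevero2019, Cor. 2.2] -/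
theorem prodLeftZ_criticalContinuity_of_signNode₁ (hD : SamePDropOfSkeletonSign₁) (hc : X.Connected) {ΔX : ℕ} (hΔ : ∀ x, X.degree x ≤ ΔX)
    (hT : IsGraphTransitive X) (x₀ : U) {t : W} (h1 : Ψ.types = {t}) (v : (U × W) × Site 1) :
    theta ((X □ Y) □ zdGraph 1) v (criticalProbIOf ((X □ Y) □ zdGraph 1) v) = 0 :=
  (Ψ.prodLeftT hc hΔ hT x₀).prodInt_criticalContinuity_of_signNode₁' hD
    (by rw [prodLeftT_types, h1, Finset.singleton_product_singleton]) v

end LineSkeletonNeg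

end Summit.CriticalPhenomena.PercolationContinuityZ3.Theorems.Transplant

end
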